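import Summits.BirchSwinnertonDyer.BirchSwinnertonDyer.Theses.SelmerRank
import Summits.BirchSwinnertonDyer.BirchSwinnertonDyer.Theses.TangentCone
import Summits.BirchSwinnertonDyer.BirchSwinnertonDyer.Theorems.SelmerRankSelmerRankLBStubDeltaOne
import Summits.BirchSwinnertonDyer.BirchSwinnertonDyer.Theorems.SelmerRankSelmerRankLBStubDeltaParity
import Summits.BirchSwinnertonDyer.BirchSwinnertonDyer.Theorems.SelmerRankSelmerRankLBStubKimOrder
import Summits.BirchSwinnertonDyer.BirchSwinnertonDyer.Theorems.SelmerRankSelmerRankLBStubDeltaPrime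
import HarnessLib

/-!
# Crux `SelmerRankLB` (stmt-BirchSwinnertonDyer-0131), line `kurihara_order` — the crux is EQUIVALENT to the even-gap vanishing V2b, modulo named literature facts

Lead prover of the line (`prover-line-stmt-BirchSwinnertonDyer-0131-0`, cycle 1, 2026-08-17).
The skeleton `Cruxes/SelmerRankLB/Lines/kurihara_order.lean` proves
`SelmerRankLB_of : K → V2a → V2b → SelmerRank.SelmerRankLB` (sorry-free composition), where after
wave 1

* V0 `stub_delta_one` and V1 `stub_delta_parity` are unconditional THEOREMS of the tree
  (`Theorems/SelmerRankSelmerRankLBStubDeltaOne.lean`, `…StubDeltaParity{,Lemmas,NormRelation}.lean`);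
* K is closed modulo the named facts `exists_isNewformOf` (modularity),
  `Kim2022_exists_kuriharaNumber_ne_zero_of_selmerCorank` (F1: Kim 2022 Thm. 1.9 (1) + Cor. 1.6) and
  `realPeriodRat_eq_unit_mul_plusPeriod` (F2: the period transfer `Ω(W) = u·Ω⁺_f` is a `p`-adic
  unit) — `stub_kim_order_le_corank_of_facts` (`…StubKimOrder.lean`);
* V2a is closed modulo `Kim2022_selmerCorank_le_of_kuriharaNumber_ne_zero` (F3: Kim 2022 Thm. 1.9 (1),
  upper direction), `yanZhu_analyticRank_eq_one_of_selmerCorank_eq_one` (F4: the corank-one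
  `p`-converse without (ram)), the `p`-parity fact `selmerCorank_mod_two_eq` and F2 —
  `stub_delta_prime_of_odd_rank_of_facts` (`…StubDeltaPrime.lean`);
* V2b `stub_delta_evenGap` — for `2 ≤ ν(n) < r_an`, `ν(n) ≡ r_an (mod 2)`, the Kurihara number
  `δ_n^{(k)}` vanishes — is the OPEN core (first instance `(r_an, ν(n)) = (4, 2)`, the rank-2
  `p`-converse in modular-symbol form).

This file records, kernel-checked, what the line has achieved: **modulo the named literature facts
{modularity, F1, F2, F3, F4, `p`-parity} the crux `SelmerRankLB` and the single open statement V2b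
are EQUIVALENT.**

* `selmerRankLB_of_evenGap_of_facts` : modularity → F1 → F2 → F3 → F4 → `p`-parity → V2b →
  `SelmerRank.SelmerRankLB` (the skeleton's composition with the landed stubs plugged in; V2b is
  written out literally as a `Prop` hypothesis — it is the registered stub `stub_delta_evenGap`, not a
  named fact, and no `def` is minted for it);
* `tangentCone_selmerRankLB_of_evenGap_of_facts` : the same for the payload route's copy
  `TangentCone.SelmerRankLB` (the six route copies are `rfl`-equal);
* `evenGap_of_selmerRankLB_of_facts` : F3 → F2 → `SelmerRank.SelmerRankLB` → V2b (the converse: if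
  `δ_n^{(k)} ≠ 0` then `corank ≤ ν(n) < r_an ≤ corank`; this is the crux-relative form of the
  disprover's `stubKV_of_summit_of_kim`, `Cruxes/SelmerRankLB/Disproof.lean`, which uses the summit).

So the line has no slack: V2b is exactly as hard as the crux from `r_an = 4` on, with every
algebraic ingredient (Selmer groups, Iwasawa theory, heights, `Ш`) discharged into F1–F4 — theorems
in print — and the analytic layers `n = 1` and "wrong parity" proved outright. All three theorems
are CONDITIONAL (`--supports` helpers registered as sub-goals by `ledger workitem stub-add`); none
closes the item.
-/

set_option linter.dupNamespace false

noncomputable section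

namespace Summit.BirchSwinnertonDyer.BirchSwinnertonDyer.Theorems

open scoped MatrixGroups ModularForm Classical
open CongruenceSubgroup Literature.NumberTheory.EllipticCurves
  Literature.NumberTheory.EllipticCurves.ModularForms WeierstrassCurve
open Summit.BirchSwinnertonDyer.BirchSwinnertonDyer.Theses

/-- A non-zero natural number other than `1` has a prime factor. [folklore] -/
theorem evenGap_one_le_card_primeFactors {n : ℕ} (h0 : n ≠ 0) (h1 : n ≠ 1) :
    1 ≤ n.primeFactors.card := by
  rw [Nat.one_le_iff_ne_zero, Ne, Finset.card_eq_zero, Nat.primeFactors_eq_empty]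
  omega

/-- **(KV) modulo V2a and V2b**: with the landed theorems V0 (`stub_delta_one`) and V1
(`stub_delta_parity`), and V2a, V2b as hypotheses (written out literally), every Kurihara number
`δ_n^{(k)}` (`k ≥ 1`, `n ∈ 𝒩_k`) with `ν(n) < r_an` vanishes at the crux's primes: case split
`n = 1` (V0) / `ν(n) + r_an` odd (V1) / `ν(n) = 1`, `r_an` odd `≥ 3` (V2a) / `ν(n) ≥ 2`, same parity
(V2b). This is the skeleton's `kuriharaNumber_eq_zero_of_lt_analyticRank`. [folklore] -/
theorem evenGap_kuriharaNumber_eq_zero_of_lt_analyticRank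
    (hV2a : ∀ (W : WeierstrassCurve ℚ) [W.IsElliptic] [W.IsGloballyMinimal] (p : ℕ) [Fact p.Prime],
      5 ≤ p → W.HasGoodReductionAtPrime p → ¬ (p : ℤ) ∣ W.frobeniusTrace p →
      W.HasSurjectiveModNGaloisRep p →
      ∀ (_ : NeZero (W.conductorNorm ℤ)) (f : CuspForm (Gamma0 (W.conductorNorm ℤ)) 2),
        IsNewformOf W f →
        ∀ (k n : ℕ) [NeZero n], 1 ≤ k → Kato.IsKolyvaginProduct W p k n → n.primeFactors.card = 1 →
          Odd W.analyticRank → 3 ≤ W.analyticRank →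
          ∀ ψ : (ℓ : ℕ) → (ZMod ℓ)ˣ →* Multiplicative (ZMod (p ^ k)),
            (∀ ℓ ∈ n.primeFactors, Function.Surjective (ψ ℓ)) →
            kuriharaNumber f (p ^ k) n ψ = 0)
    (hV2b : ∀ (W : WeierstrassCurve ℚ) [W.IsElliptic] [W.IsGloballyMinimal] (p : ℕ) [Fact p.Prime],
      5 ≤ p → W.HasGoodReductionAtPrime p → ¬ (p : ℤ) ∣ W.frobeniusTrace p →
      W.HasSurjectiveModNGaloisRep p →
      ∀ (_ : NeZero (W.conductorNorm ℤ)) (f : CuspForm (Gamma0 (W.conductorNorm ℤ)) 2),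
        IsNewformOf W f →
        ∀ (k n : ℕ) [NeZero n], 1 ≤ k → Kato.IsKolyvaginProduct W p k n → 2 ≤ n.primeFactors.card →
          Even (n.primeFactors.card + W.analyticRank) →
          n.primeFactors.card < W.analyticRank →
          ∀ ψ : (ℓ : ℕ) → (ZMod ℓ)ˣ →* Multiplicative (ZMod (p ^ k)),
            (∀ ℓ ∈ n.primeFactors, Function.Surjective (ψ ℓ)) →
            kuriharaNumber f (p ^ k) n ψ = 0)
    (W : WeierstrassCurve ℚ) [W.IsElliptic] [W.IsGloballyMinimal] (p : ℕ) [Fact p.Prime]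
    (h5 : 5 ≤ p) (hgood : W.HasGoodReductionAtPrime p) (hord : ¬ (p : ℤ) ∣ W.frobeniusTrace p)
    (hsurj : W.HasSurjectiveModNGaloisRep p)
    (hN : NeZero (W.conductorNorm ℤ)) (f : CuspForm (Gamma0 (W.conductorNorm ℤ)) 2)
    (hf : IsNewformOf W f) (k n : ℕ) [hn0 : NeZero n] (hk : 1 ≤ k)
    (hn : Kato.IsKolyvaginProduct W p k n) (hν : n.primeFactors.card < W.analyticRank)
    (ψ : (ℓ : ℕ) → (ZMod ℓ)ˣ →* Multiplicative (ZMod (p ^ k)))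
    (hψ : ∀ ℓ ∈ n.primeFactors, Function.Surjective (ψ ℓ)) :
    kuriharaNumber f (p ^ k) n ψ = 0 := by
  rcases eq_or_ne n 1 with rfl | hn1
  · exact stub_delta_one W p hN f hf (by omega) k ψ
  · rcases Nat.even_or_odd (n.primeFactors.card + W.analyticRank) with he | ho
    · have h1 : 1 ≤ n.primeFactors.card := evenGap_one_le_card_primeFactors hn0.out hn1
      rcases h1.eq_or_lt with h1' | h2
      · -- ν(n) = 1 and 1 + r_an even: r_an is odd and ≥ 3
        have hodd : Odd W.analyticRank := by
          rw [← h1'] at he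
          exact (Nat.even_add_one (n := W.analyticRank)).mp (by simpa [add_comm] using he) |>
            Nat.not_even_iff_odd.mp
        have h3 : 3 ≤ W.analyticRank := by
          obtain ⟨m, hm⟩ := hodd
          omega
        exact hV2a W p h5 hgood hord hsurj hN f hf k n hk hn h1'.symm hodd h3 ψ hψ
      · exact hV2b W p h5 hgood hord hsurj hN f hf k n hk hn h2 he hν ψ hψ
    · exact stub_delta_parity W p h5 hgood hord hsurj hN f hf k n hk hn (Nat.not_even_iff_odd.mpr ho)
        ψ hψ

/-- **The crux modulo named literature facts and the open stub V2b.** Hypotheses, in order: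
modularity `exists_isNewformOf` (BCDT 2001); F1 `Kim2022_exists_kuriharaNumber_ne_zero_of_selmerCorank`
(Kim 2022 Thm. 1.9 (1) + Cor. 1.6: some Kurihara number with `ν(n) ≤ corank_p` is non-zero); F2
`realPeriodRat_eq_unit_mul_plusPeriod` (the period transfer is a `p`-adic unit); F3
`Kim2022_selmerCorank_le_of_kuriharaNumber_ne_zero` (Kim 2022 Thm. 1.9 (1), upper direction); F4
`yanZhu_analyticRank_eq_one_of_selmerCorank_eq_one` (corank-one `p`-converse without (ram)); the
`p`-parity theorem `selmerCorank_mod_two_eq` for all elliptic `E/ℚ` and primes `p`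
(Dokchitser–Dokchitser 2010); and the OPEN even-gap vanishing V2b, written out literally (it is the
registered stub `stub_delta_evenGap` of the line, first open instance `(r_an, ν(n)) = (4, 2)`).
Consequent: the crux `SelmerRank.SelmerRankLB` by name. Proof: if `corank_p < r_an`, the witness
`n` of K (`stub_kim_order_le_corank_of_facts`) has `ν(n) ≤ corank_p < r_an`, so its Kurihara number
vanishes by (KV) (`evenGap_kuriharaNumber_eq_zero_of_lt_analyticRank`, with V2a supplied by
`stub_delta_prime_of_odd_rank_of_facts`) — contradiction. CONDITIONAL; credits nothing to the item.
[cite: Kim2022StructureSelmer, Thm. 1.9 (1) and Cor. 1.6 (PDF pp. 6–7)] -/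
theorem selmerRankLB_of_evenGap_of_facts :
    exists_isNewformOf → Kim2022_exists_kuriharaNumber_ne_zero_of_selmerCorank →
    realPeriodRat_eq_unit_mul_plusPeriod →
    Literature.NumberTheory.EllipticCurves.Kim2022_selmerCorank_le_of_kuriharaNumber_ne_zero →
    Literature.NumberTheory.EllipticCurves.yanZhu_analyticRank_eq_one_of_selmerCorank_eq_one →
    (∀ (W : WeierstrassCurve ℚ) [W.IsElliptic] (p : ℕ) [Fact p.Prime],
      Literature.NumberTheory.EllipticCurves.selmerCorank_mod_two_eq W p) →
    (∀ (W : WeierstrassCurve ℚ) [W.IsElliptic] [W.IsGloballyMinimal] (p : ℕ) [Fact p.Prime],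
      5 ≤ p → W.HasGoodReductionAtPrime p → ¬ (p : ℤ) ∣ W.frobeniusTrace p →
      W.HasSurjectiveModNGaloisRep p →
      ∀ (_ : NeZero (W.conductorNorm ℤ)) (f : CuspForm (Gamma0 (W.conductorNorm ℤ)) 2),
        IsNewformOf W f →
        ∀ (k n : ℕ) [NeZero n], 1 ≤ k → Kato.IsKolyvaginProduct W p k n → 2 ≤ n.primeFactors.card →
          Even (n.primeFactors.card + W.analyticRank) →
          n.primeFactors.card < W.analyticRank →
          ∀ ψ : (ℓ : ℕ) → (ZMod ℓ)ˣ →* Multiplicative (ZMod (p ^ k)),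
            (∀ ℓ ∈ n.primeFactors, Function.Surjective (ψ ℓ)) →
            kuriharaNumber f (p ^ k) n ψ = 0) →
    SelmerRank.SelmerRankLB := by
  intro hmod hF1 hF2 hF3 hF4 hpar hV2b W _ _ p _ h5 hgood hord hsurj
  have hirrF2 : ∀ (W : WeierstrassCurve ℚ) [W.IsElliptic] [W.IsGloballyMinimal] (p : ℕ)
      [Fact p.Prime], 5 ≤ p → W.HasGoodReductionAtPrime p → W.HasIrreducibleModPGaloisRep p →
      ∀ {N : ℕ} [NeZero N] (f : CuspForm (Gamma0 N) 2), IsNewformOf W f →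
      ∃ u : ℚ, ‖(u : ℚ_[p])‖ = 1 ∧ W.realPeriodRat = u * plusPeriod f :=
    fun W _ _ p _ h5 hgood hirr _ _ f hf ↦ hF2 W p h5 hgood hirr f hf
  obtain ⟨hN, f, hf, k, n, hn0, hk, hkoly, hνle, ψ, hψ, hne⟩ :=
    stub_kim_order_le_corank_of_facts hmod hF1 hF2 W p h5 hgood hord hsurj
  by_contra hlt
  push Not at hlt
  haveI := hn0
  exact hne (evenGap_kuriharaNumber_eq_zero_of_lt_analyticRank
    (stub_delta_prime_of_odd_rank_of_facts hF3 hF4 hpar hirrF2) hV2b W p h5 hgood hord hsurj hN f hf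
    k n hk hkoly (lt_of_le_of_lt hνle hlt) ψ hψ)

/-- The same for the payload route's copy `TangentCone.SelmerRankLB` (the six route copies of the
shared item are `rfl`-equal, `Cruxes/SelmerRankLB/CruxAttackProbes.lean`). CONDITIONAL.
[cite: Kim2022StructureSelmer, Thm. 1.9 (1) and Cor. 1.6 (PDF pp. 6–7)] -/
theorem tangentCone_selmerRankLB_of_evenGap_of_facts :
    exists_isNewformOf → Kim2022_exists_kuriharaNumber_ne_zero_of_selmerCorank →
    realPeriodRat_eq_unit_mul_plusPeriod →
    Literature.NumberTheory.EllipticCurves.Kim2022_selmerCorank_le_of_kuriharaNumber_ne_zero →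
    Literature.NumberTheory.EllipticCurves.yanZhu_analyticRank_eq_one_of_selmerCorank_eq_one →
    (∀ (W : WeierstrassCurve ℚ) [W.IsElliptic] (p : ℕ) [Fact p.Prime],
      Literature.NumberTheory.EllipticCurves.selmerCorank_mod_two_eq W p) →
    (∀ (W : WeierstrassCurve ℚ) [W.IsElliptic] [W.IsGloballyMinimal] (p : ℕ) [Fact p.Prime],
      5 ≤ p → W.HasGoodReductionAtPrime p → ¬ (p : ℤ) ∣ W.frobeniusTrace p →
      W.HasSurjectiveModNGaloisRep p →
      ∀ (_ : NeZero (W.conductorNorm ℤ)) (f : CuspForm (Gamma0 (W.conductorNorm ℤ)) 2),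
        IsNewformOf W f →
        ∀ (k n : ℕ) [NeZero n], 1 ≤ k → Kato.IsKolyvaginProduct W p k n → 2 ≤ n.primeFactors.card →
          Even (n.primeFactors.card + W.analyticRank) →
          n.primeFactors.card < W.analyticRank →
          ∀ ψ : (ℓ : ℕ) → (ZMod ℓ)ˣ →* Multiplicative (ZMod (p ^ k)),
            (∀ ℓ ∈ n.primeFactors, Function.Surjective (ψ ℓ)) →
            kuriharaNumber f (p ^ k) n ψ = 0) →
    TangentCone.SelmerRankLB :=
  selmerRankLB_of_evenGap_of_facts

/-- **Conversely, the crux implies V2b modulo F3 and F2**: at the crux's primes, with `f` the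
newform, `k ≥ 1`, `n ∈ 𝒩_k`, `ν(n) < r_an` and surjective logarithms, a non-zero `δ_n^{(k)}` would
give `corank_p ≤ ν(n)` (F3 `Kim2022_selmerCorank_le_of_kuriharaNumber_ne_zero`, its period
hypothesis from F2 `realPeriodRat_eq_unit_mul_plusPeriod` at the irreducible prime `p`,
`hasIrreducibleModPGaloisRep_of_hasSurjectiveModNGaloisRep`), contradicting `r_an ≤ corank_p` (the
crux). The side conditions `2 ≤ ν(n)` and parity of V2b are not used (cf. `Disproof.lean`,
`stubKV_of_summit_of_kim`, the same argument from the summit instead of the crux). Together with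
`selmerRankLB_of_evenGap_of_facts`: modulo {modularity, F1, F2, F3, F4, `p`-parity} the crux and V2b
are equivalent — the line isolates the open content exactly, with no slack. CONDITIONAL.
[cite: Kim2022StructureSelmer, Thm. 1.9 (1) (PDF p. 7)] -/
theorem evenGap_of_selmerRankLB_of_facts :
    Literature.NumberTheory.EllipticCurves.Kim2022_selmerCorank_le_of_kuriharaNumber_ne_zero →
    realPeriodRat_eq_unit_mul_plusPeriod → SelmerRank.SelmerRankLB →
    ∀ (W : WeierstrassCurve ℚ) [W.IsElliptic] [W.IsGloballyMinimal] (p : ℕ) [Fact p.Prime],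
      5 ≤ p → W.HasGoodReductionAtPrime p → ¬ (p : ℤ) ∣ W.frobeniusTrace p →
      W.HasSurjectiveModNGaloisRep p →
      ∀ (_ : NeZero (W.conductorNorm ℤ)) (f : CuspForm (Gamma0 (W.conductorNorm ℤ)) 2),
        IsNewformOf W f →
        ∀ (k n : ℕ) [NeZero n], 1 ≤ k → Kato.IsKolyvaginProduct W p k n → 2 ≤ n.primeFactors.card →
          Even (n.primeFactors.card + W.analyticRank) →
          n.primeFactors.card < W.analyticRank →
          ∀ ψ : (ℓ : ℕ) → (ZMod ℓ)ˣ →* Multiplicative (ZMod (p ^ k)),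
            (∀ ℓ ∈ n.primeFactors, Function.Surjective (ψ ℓ)) →
            kuriharaNumber f (p ^ k) n ψ = 0 := by
  intro hF3 hF2 hLB W _ _ p _ h5 hgood hord hsurj hN f hf k n _ hk hn _ _ hν ψ hψ
  by_contra hne
  haveI := hN
  have hirr : W.HasIrreducibleModPGaloisRep p :=
    hasIrreducibleModPGaloisRep_of_hasSurjectiveModNGaloisRep W p hsurj
  have hle : W.selmerCorank p ≤ n.primeFactors.card :=
    hF3 W p h5 hgood hord hsurj f hf (hF2 W p h5 hgood hirr f hf) k n hk hn ψ hψ hne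
  have hcrux : W.analyticRank ≤ W.selmerCorank p := hLB W p h5 hgood hord hsurj
  omega

/-- **The known range of the crux, recovered along the line.** Modulo the named facts
{modularity `exists_isNewformOf`, F1, F2, F3, F4, `p`-parity} and NO open hypothesis, every curve in
the crux's range with `ord_{s=1} L(E, s) ≤ 3` satisfies `r_an ≤ corank_p Sel_{p^∞}`: the K-witness
`n` (`stub_kim_order_le_corank_of_facts`) has `ν(n) ≤ corank_p < r_an ≤ 3`, and its Kurihara number
vanishes by V0 (`n = 1`, theorem `stub_delta_one`), V1 (wrong parity, theorem `stub_delta_parity`)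
or V2a (`ν(n) = 1`, `r_an = 3`, `stub_delta_prime_of_odd_rank_of_facts`); the even-gap case
`ν(n) = 2 < r_an = 3` has odd `ν + r_an` and does not occur. `r_an ≤ 3` is exactly the range in which
the crux is a theorem in print (corank-0/1 `p`-converses + `p`-parity); along the line it comes out
of Kim's structure theorem (F1, F3), the corank-1 `p`-converse (F4), parity and the Mazur–Tate
functional equation — which makes explicit that the line adds nothing below `r_an = 4` and isolates
everything from `r_an = 4` on into V2b. CONDITIONAL on the six named facts; credits nothing.
[cite: Kim2022StructureSelmer, Thm. 1.9 (1) and Cor. 1.6 (PDF pp. 6–7)] -/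
theorem selmerRankLB_of_facts_of_analyticRank_le_three :
    exists_isNewformOf → Kim2022_exists_kuriharaNumber_ne_zero_of_selmerCorank →
    realPeriodRat_eq_unit_mul_plusPeriod →
    Literature.NumberTheory.EllipticCurves.Kim2022_selmerCorank_le_of_kuriharaNumber_ne_zero →
    Literature.NumberTheory.EllipticCurves.yanZhu_analyticRank_eq_one_of_selmerCorank_eq_one →
    (∀ (W : WeierstrassCurve ℚ) [W.IsElliptic] (p : ℕ) [Fact p.Prime],
      Literature.NumberTheory.EllipticCurves.selmerCorank_mod_two_eq W p) →
    ∀ (W : WeierstrassCurve ℚ) [W.IsElliptic] [W.IsGloballyMinimal] (p : ℕ) [Fact p.Prime],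
      5 ≤ p → W.HasGoodReductionAtPrime p → ¬ (p : ℤ) ∣ W.frobeniusTrace p →
      W.HasSurjectiveModNGaloisRep p → W.analyticRank ≤ 3 → W.analyticRank ≤ W.selmerCorank p := by
  intro hmod hF1 hF2 hF3 hF4 hpar W _ _ p _ h5 hgood hord hsurj h3
  have hirrF2 : ∀ (W : WeierstrassCurve ℚ) [W.IsElliptic] [W.IsGloballyMinimal] (p : ℕ)
      [Fact p.Prime], 5 ≤ p → W.HasGoodReductionAtPrime p → W.HasIrreducibleModPGaloisRep p →
      ∀ {N : ℕ} [NeZero N] (f : CuspForm (Gamma0 N) 2), IsNewformOf W f →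
      ∃ u : ℚ, ‖(u : ℚ_[p])‖ = 1 ∧ W.realPeriodRat = u * plusPeriod f :=
    fun W _ _ p _ h5 hgood hirr _ _ f hf ↦ hF2 W p h5 hgood hirr f hf
  obtain ⟨hN, f, hf, k, n, hn0, hk, hkoly, hνle, ψ, hψ, hne⟩ :=
    stub_kim_order_le_corank_of_facts hmod hF1 hF2 W p h5 hgood hord hsurj
  by_contra hlt
  push Not at hlt
  haveI := hn0
  have hν : n.primeFactors.card < W.analyticRank := lt_of_le_of_lt hνle hlt
  apply hne
  rcases eq_or_ne n 1 with rfl | hn1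
  · exact stub_delta_one W p hN f hf (by omega) k ψ
  · rcases Nat.even_or_odd (n.primeFactors.card + W.analyticRank) with he | ho
    · have h1 : 1 ≤ n.primeFactors.card := evenGap_one_le_card_primeFactors hn0.out hn1
      rcases h1.eq_or_lt with h1' | h2
      · -- ν(n) = 1 and 1 + r_an even: r_an is odd, hence = 3
        have hodd : Odd W.analyticRank := by
          rw [← h1'] at he
          exact (Nat.even_add_one (n := W.analyticRank)).mp (by simpa [add_comm] using he) |>
            Nat.not_even_iff_odd.mp
        have h3' : 3 ≤ W.analyticRank := by
          obtain ⟨m, hm⟩ := hodd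
          omega
        exact stub_delta_prime_of_odd_rank_of_facts hF3 hF4 hpar hirrF2 W p h5 hgood hord hsurj hN f
          hf k n hk hkoly h1'.symm hodd h3' ψ hψ
      · -- even gap: `2 ≤ ν(n) < r_an ≤ 3` forces `ν = 2`, `r_an = 3`, but then `ν + r_an` is odd
        exfalso
        obtain ⟨m, hm⟩ := he
        omega
    · exact stub_delta_parity W p h5 hgood hord hsurj hN f hf k n hk hkoly
        (Nat.not_even_iff_odd.mpr ho) ψ hψ

end Summit.BirchSwinnertonDyer.BirchSwinnertonDyer.Theorems

end
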